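import Literature.NumberTheory.LFunctions.Zhang2022.RepairIntakeBdet
import Literature.NumberTheory.LFunctions.Zhang2022.DetectorDoublingCompose
import Literature.NumberTheory.LFunctions.Zhang2022.DetectorEntangledConePSD

/-!
# Zhang (2022) §18-margin repair rung, barrier extension (cell landau-siegel §E; B-det word qualifier (b)):
# ROW 40 FLIPPED — the entangled class-DET detector family with the E-102 member REMOVED from the verdict

Y. Zhang, *Discrete mean estimates and the Landau–Siegel zero*, arXiv:2211.02515v1 (2022) [Zhang2022LandauSiegel] —
an unrefereed manuscript under adjudication. **WHAT THIS IS NOT: a claim about its Theorems 1–2, about Landau–Siegel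
zeros, about Parity, or about a repaired `Margin232`. The programme SEARCHES and TYPES; no claim about Landau–Siegel
zeros, Theorems 1–2 of arXiv:2211.02515 or a repaired Margin232 until a kernel theorem says so.**

## What this leaf does (bookkeeping over landed calculus; no numerics, no new `Prop` facts)

Row 40 of the class of record is `Repair.familyDetEntangled` (`RepairDetEntangled`, p475645): designs `(K, a, b, h, h′)` =
an ENTANGLED class-DET detector `Σ_ρ (iM′)²α³·x_a·|Σ_j x_jA_{h_j}|²·ω` (widened clause (i′) of the B-det word) — anchor shift
multiple `a ∈ (0,1)`, finite palette `b : Fin K → (0,5)` (Part-III contour box), profile vector `h` of ONE-SIDED kinked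
profiles vanishing at the top (range (7.2) of Prop. 7.1) — NO analytic hypothesis in the class; its verdict DISPLAYS the
E-102 MEMBER `Det.ConePSD d.a d.b` («IF the block moment matrix `BigF(a;b)` of the anchor and palette is PSD on one-sided
kinked profiles THEN `¬ (Re m(a;b;h) < 0)`», `m = Det.entangledMain`, `DetectorEntangledCone` p473997).

The slot is registry row E-102 HEAD 1, `Det.EdetCone (Set.Ioo 0 1) (Set.Ioo 0 5)` (`DetectorEntangledCone`, p473997):
`∀ K a, a ∈ (0,1) → ∀ b : Fin K → ℝ, (∀ j, b j ∈ (0,5)) → ConePSD a b`; the full premise of the B-det word is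
`Det.EdetPremise (Set.Ioo 0 1) (Set.Ioo 0 5) = EdetCone ∧ MonomialConePSD` (p476440), whose HEAD 2 `Det.MonomialConePSD
(Set.Ioo 0 5)` IS the tree theorem `Det.monomialConePSD_unit` (DOUBLING route [K1]–[K6], `DetectorDoublingCompose` Part 3,
p490608) — so `EdetPremise (0,1) (0,5) ↔ EdetCone (0,1) (0,5)` (`Det.edetPremise_unit_iff_edetCone`). This leaf records the
flip of row 40 and of the B-det intake word `Repair.bdetWord2` / `Repair.familyBdet2` (`RepairIntakeBdet` Part 5, p477601):

* Part 1 (interface form, GIVEN head 1): `Repair.detEntangled_not_closing_of_edetCone` — under `EdetCone (0,1) (0,5)` every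
  member of row 40 satisfies the verdict's CONCLUSION outright; the slot-free family **`Repair.familyDetEntangledUncond`**
  (same designs, same class predicate — `familyDetEntangledUncond_sameClass` — verdict = the bare conclusion
  `¬ (Re m(a;b;h) < 0)`), decided GIVEN head 1 (`familyDetEntangledUncond_decided_of_edetCone`,
  `rplus_detEntangledUncond_decided_of_edetCone`); the slot-free verdict implies row 40's
  (`familyDetEntangled_verdict_of_uncond`); and THE WORD AT INTAKE LEVEL GIVEN HEAD 1 ALONE
  (`Repair.bdet2_verdicts_of_edetCone`): both conditional rows of `bdetWord2` — `familyDetShift` (E-010 slot, head 2, now a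
  theorem) and `familyDetEntangled` (E-102 member, head 1) — read OUTRIGHT, i.e. qualifier (b) «GIVEN E-102» of
  KILL(B-det) INSIDE DET reduces to head 1.
* Part 2 (E-102 head 1 IS a tree theorem — `Det.edetCone_unit` / `Det.conePSD_of_mem_Ioo` / `Det.edetPremise_unit`,
  `DetectorEntangledConePSD` (ls-barrier-p2 g4), by the SUM-OF-SQUARES route R3a v2: moment identities
  `DetectorEntangledMomentSOS` (p493460) / `…Confluent` / `…All` (ls-num-2 g4 p494353, p495099), block + palette boundary SOS
  `DetectorEntangledSOS` (p496210), `u`-factorisation / Picone / bulk Gram / reduction `DetectorEntangledBulkFreeEnd` +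
  `DetectorEntangledUForm` (ls-Bdet-typer-1 g4 p492410, p494055–p495593; `Det.conePSD_of_re_boundaryBracket_nonneg_jets`),
  L-B′1 `DetectorAnchorKernel` (ls-Bdet-num-2 g4 p488885)): the HYPOTHESIS-FREE versions —
  **`Repair.detEntangled_not_closing : ∀ d : DetEntangledDesign, d.InClass → d.VerdictFree`** (row 40's conclusion OUTRIGHT,
  class-wide), `familyDetEntangledUncond_decided`, `rplus_detEntangledUncond_decided`, the member on the class
  (`DetEntangledDesign.InClass.slot`), and **`Repair.bdet2_verdicts`** = BOTH conditional rows of the B-det intake word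
  OUTRIGHT — KILL(B-det) INSIDE DET with qualifier (b) «GIVEN E-102» DISCHARGED in the kernel (`bdet2_slots`: every displayed
  slot of `familyBdet2` holds on its class).

Currency (C3(e)): `Det.entangledMain a b h h′ = hᵀ·BigF(a;b)·h` = the continued formula-I calculus (confluent divided-difference
recipe at repeated nodes) of the entangled detector's (A)-main term on ONE-SIDED kinked profiles (registry E-010(i) +
repeated-shift rule + E-080: the derivation is not asserted). Nothing here is a statement about zeros. Standard axioms.

References: Y. Zhang, arXiv:2211.02515v1 (2022), §2 (2.13), (2.15)–(2.18), Lemma 2.3 and its proof, Props. 2.4–2.6,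
(2.32)–(2.33) [pp. 5–6, 10–11]; §7 Prop. 7.1, (7.2), (7.19)–(7.21) [p. 44]; §8 (8.11)–(8.23).
[cite: Zhang2022LandauSiegel, §§2, 7, 8]
-/

noncomputable section

open Real Complex ComplexConjugate

namespace Literature.NumberTheory.LFunctions.Zhang2022

namespace Repair

open Det

/-! ### Part 1 — the flip in interface form, GIVEN E-102 head 1 `Det.EdetCone (Set.Ioo 0 1) (Set.Ioo 0 5)` -/

namespace DetEntangledDesign

/-- **The slot-free verdict of an entangled class-DET design**: the bare conclusion «no POS closing at main order»,
`¬ (Re m(a;b;h) < 0)` — row 40's verdict with the E-102 member removed.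
[cite: Zhang2022LandauSiegel, §2 (2.16), (2.32)–(2.33); §7 Prop. 7.1 p.44] -/
def VerdictFree (d : DetEntangledDesign) : Prop :=
  ¬ ((entangledMain d.a d.b d.h d.h').re < 0)

/-- Row 40's verdict IS «member → slot-free verdict» (definitional bookkeeping).
[cite: Zhang2022LandauSiegel, §2 (2.32)–(2.33)] -/
theorem verdict_iff_slot_imp_free (d : DetEntangledDesign) :
    d.Verdict ↔ (ConePSD d.a d.b → d.VerdictFree) :=
  Iff.rfl

/-- The slot-free verdict implies row 40's displayed-member verdict. [cite: Zhang2022LandauSiegel, §2 (2.32)–(2.33)] -/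
theorem verdict_of_verdictFree (d : DetEntangledDesign) (h : d.VerdictFree) : d.Verdict := fun _ => h

/-- A member's anchor lies in `(0,1)` (class predicate read as set membership). [cite: Zhang2022LandauSiegel, §2 (2.13), Lemma 2.3] -/
theorem InClass.mem_anchor {d : DetEntangledDesign} (h : d.InClass) : d.a ∈ Set.Ioo (0:ℝ) 1 :=
  h.1

/-- A member's palette lies in the E-102 box `(0,5)` channel by channel. [cite: Zhang2022LandauSiegel, §2 (2.13); §14 (14.2)] -/
theorem InClass.mem_box {d : DetEntangledDesign} (h : d.InClass) : ∀ j, d.b j ∈ Set.Ioo (0:ℝ) 5 :=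
  fun j => h.2.1 j

/-- Under E-102 head 1 the member of every design in the class holds. [cite: Zhang2022LandauSiegel, §7 Prop. 7.1 p.44, (7.2)] -/
theorem InClass.slot_of_edetCone {d : DetEntangledDesign} (hE : EdetCone (Set.Ioo 0 1) (Set.Ioo 0 5))
    (h : d.InClass) : ConePSD d.a d.b :=
  hE.conePSD h.mem_anchor h.mem_box

end DetEntangledDesign

/-- **ROW 40 FLIPPED, interface form.** GIVEN E-102 head 1 (`Det.EdetCone (Set.Ioo 0 1) (Set.Ioo 0 5)`), every design of the
entangled class-DET family — any anchor in `(0,1)`, any finite palette in `(0,5)`, any one-sided kinked profile vector —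
satisfies `¬ (Re m(a;b;h) < 0)` OUTRIGHT (`not_repairable_detEntangled` with the member fed from head 1).
[cite: Zhang2022LandauSiegel, §2 (2.16), (2.32)–(2.33); §7 Prop. 7.1 p.44] -/
theorem detEntangled_not_closing_of_edetCone (hE : EdetCone (Set.Ioo 0 1) (Set.Ioo 0 5)) :
    ∀ d : DetEntangledDesign, d.InClass → d.VerdictFree :=
  fun d h => not_repairable_detEntangled d h (h.slot_of_edetCone hE)

/-! ### The slot-free family (extension protocol of `RepairRplus`) -/

/-- **family «entangled class-DET detector, one-sided profiles, block-form currency — SLOT-FREE verdict»**: the designs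
and the class predicate of row 40 (`familyDetEntangled`) verbatim; the verdict is the bare conclusion `¬ (Re m(a;b;h) < 0)`
(nothing displayed, nothing conditional in the class). [cite: Zhang2022LandauSiegel, §2 (2.16), (2.32)–(2.33)] -/
def familyDetEntangledUncond : DesignFamily where
  Design := DetEntangledDesign
  InClass := DetEntangledDesign.InClass
  Verdict := DetEntangledDesign.VerdictFree

/-- **Same designs, same class as row 40** — only the verdict changed (member removed).
[cite: Zhang2022LandauSiegel, §2 (2.32)–(2.33)] -/
theorem familyDetEntangledUncond_sameClass :
    familyDetEntangledUncond.Design = familyDetEntangled.Design ∧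
      ∀ d : DetEntangledDesign, familyDetEntangledUncond.InClass d ↔ familyDetEntangled.InClass d :=
  ⟨rfl, fun _ => Iff.rfl⟩

/-- The slot-free verdict unfolded. [cite: Zhang2022LandauSiegel, §2 (2.16), (2.32)–(2.33)] -/
theorem familyDetEntangledUncond_verdict_iff (d : DetEntangledDesign) :
    familyDetEntangledUncond.Verdict d ↔ ¬ ((entangledMain d.a d.b d.h d.h').re < 0) :=
  Iff.rfl

/-- The slot-free verdict implies row 40's verdict (member displayed). [cite: Zhang2022LandauSiegel, §2 (2.32)–(2.33)] -/
theorem familyDetEntangled_verdict_of_uncond (d : DetEntangledDesign) (h : familyDetEntangledUncond.Verdict d) :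
    familyDetEntangled.Verdict d :=
  fun _ => h

/-- Row 40's verdict together with the member gives the slot-free verdict. [cite: Zhang2022LandauSiegel, §2 (2.32)–(2.33)] -/
theorem familyDetEntangledUncond_verdict_of_slot (d : DetEntangledDesign) (hV : familyDetEntangled.Verdict d)
    (hP : ConePSD d.a d.b) : familyDetEntangledUncond.Verdict d :=
  hV hP

/-- GIVEN head 1, the slot-free family is decided. [cite: Zhang2022LandauSiegel, §2 (2.32)–(2.33); §7 Prop. 7.1 p.44] -/
theorem familyDetEntangledUncond_decided_of_edetCone (hE : EdetCone (Set.Ioo 0 1) (Set.Ioo 0 5)) :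
    familyDetEntangledUncond.Decided :=
  detEntangled_not_closing_of_edetCone hE

/-- GIVEN head 1, `R⁺ ++ [familyDetEntangledUncond]` is decided. [cite: Zhang2022LandauSiegel, §2 (2.32)–(2.33)] -/
theorem rplus_detEntangledUncond_decided_of_edetCone (hE : EdetCone (Set.Ioo 0 1) (Set.Ioo 0 5)) :
    ClassDecided (Rplus ++ [familyDetEntangledUncond]) :=
  rplus_extend (familyDetEntangledUncond_decided_of_edetCone hE)

/-! ### The B-det word at intake level, GIVEN head 1 ALONE (head 2 is the tree theorem `Det.monomialConePSD_unit`) -/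

/-- **E-102 in full from its head 1**: `EdetPremise (0,1) (0,5)` follows from `EdetCone (0,1) (0,5)` because head 2
`MonomialConePSD (0,5)` is the tree theorem `Det.monomialConePSD_unit` (DOUBLING route, p490608).
[cite: Zhang2022LandauSiegel, §7 Prop. 7.1 p.44 with (7.2), (8.11)–(8.23)] -/
theorem edetPremise_of_edetCone (hE : EdetCone (Set.Ioo 0 1) (Set.Ioo 0 5)) :
    EdetPremise (Set.Ioo 0 1) (Set.Ioo 0 5) :=
  edetPremise_unit_iff_edetCone.2 hE

/-- **KILL(B-det) INSIDE DET, qualifier (b) reduced to head 1.** GIVEN `Det.EdetCone (Set.Ioo 0 1) (Set.Ioo 0 5)`, BOTH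
conditional rows of the intake word `bdetWord2` read OUTRIGHT: every `w2` member (sign-admissible shift detector in the box,
one-sided kinked legs) satisfies `¬ (𝔅_b(u)·𝔅_b(f) < ‖P_b(u,f)‖²)`, and every `entangled` member satisfies `¬ (Re m < 0)`
(`Repair.bdet2_verdicts_of_edetPremise` ∘ `edetPremise_of_edetCone`).
[cite: Zhang2022LandauSiegel, §2 (2.16), (2.18), (2.32)–(2.33); §7 Prop. 7.1 (7.2)] -/
theorem bdet2_verdicts_of_edetCone (hE : EdetCone (Set.Ioo 0 1) (Set.Ioo 0 5)) :
    (∀ d : DetShiftDesign, KBdet (.w2 d) →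
        ¬ (FormDet (shiftRecipe d.b) d.u d.u' * FormDet (shiftRecipe d.b) d.f d.f'
            < ‖FormDetPolar (shiftRecipe d.b) d.u d.u' d.f d.f'‖ ^ 2)) ∧
      ∀ e : DetEntangledDesign, KBdet2 (.entangled e) → ¬ ((entangledMain e.a e.b e.h e.h').re < 0) :=
  bdet2_verdicts_of_edetPremise (edetPremise_of_edetCone hE)

/-- The `w2` half is already hypothesis-free (head 2 in tree): every sign-admissible shift detector in the box, on any
one-sided kinked legs, satisfies `¬ (𝔅_b(u)·𝔅_b(f) < ‖P_b(u,f)‖²)`. [cite: Zhang2022LandauSiegel, §2 (2.18), (2.32)–(2.33); §7 Prop. 7.1 p.44] -/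
theorem bdet_w2_verdictFree (d : DetShiftDesign) (h : KBdet (.w2 d)) :
    ¬ (FormDet (shiftRecipe d.b) d.u d.u' * FormDet (shiftRecipe d.b) d.f d.f'
        < ‖FormDetPolar (shiftRecipe d.b) d.u d.u' d.f d.f'‖ ^ 2) :=
  not_repairable_detShift d h (monomialConePSD_unit d.b h.1 fun j => h.2.1 j)

/-! ### Part 2 — HYPOTHESIS-FREE: E-102 head 1 is the tree theorem `Det.edetCone_unit` (SOS route R3a v2:
ls-barrier-p2 g4 `DetectorEntangledConePSD`, ls-Bdet-typer-1 g4 `DetectorEntangledUForm`, L-B′1 `DetectorAnchorKernel`) -/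

section Unconditional

/-- **The member on the class**: every design of row 40 has `ConePSD d.a d.b` (E-102 head 1 in tree).
[cite: Zhang2022LandauSiegel, §7 Prop. 7.1 p.44 with (7.2), (7.19)–(7.21), (8.11)–(8.23)] -/
theorem DetEntangledDesign.InClass.slot {d : DetEntangledDesign} (h : d.InClass) : ConePSD d.a d.b :=
  h.slot_of_edetCone edetCone_unit

/-- **ROW 40 UNCONDITIONAL, class-wide**: every entangled class-DET detector — any anchor in `(0,1)`, any finite palette in
`(0,5)`, any one-sided kinked profile vector — satisfies `¬ (Re m(a;b;h) < 0)` OUTRIGHT.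
[cite: Zhang2022LandauSiegel, §2 (2.16), (2.32)–(2.33); §7 Prop. 7.1 p.44] -/
theorem detEntangled_not_closing : ∀ d : DetEntangledDesign, d.InClass → d.VerdictFree :=
  detEntangled_not_closing_of_edetCone edetCone_unit

/-- the inequality itself on the class, hypothesis-free: `0 ≤ Re m(a;b;h)`. [cite: Zhang2022LandauSiegel, §2 (2.16), (2.32)] -/
theorem detEntangled_nonneg_unconditional (d : DetEntangledDesign) (h : d.InClass) :
    0 ≤ (entangledMain d.a d.b d.h d.h').re :=
  detEntangled_nonneg d h h.slot

/-- Row 40's verdict AND its member, both outright, for every design in the class.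
[cite: Zhang2022LandauSiegel, §2 (2.32)–(2.33); §7 Prop. 7.1 p.44] -/
theorem familyDetEntangled_verdict_and_slot (d : DetEntangledDesign) (h : d.InClass) :
    familyDetEntangled.Verdict d ∧ ConePSD d.a d.b :=
  ⟨familyDetEntangled_decided d h, h.slot⟩

/-- **The slot-free family is decided** (hypothesis-free). [cite: Zhang2022LandauSiegel, §2 (2.32)–(2.33); §7 Prop. 7.1 p.44] -/
theorem familyDetEntangledUncond_decided : familyDetEntangledUncond.Decided := detEntangled_not_closing

/-- `R⁺ ++ [familyDetEntangledUncond]` is decided. [cite: Zhang2022LandauSiegel, §2 (2.32)–(2.33)] -/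
theorem rplus_detEntangledUncond_decided : ClassDecided (Rplus ++ [familyDetEntangledUncond]) :=
  rplus_extend familyDetEntangledUncond_decided

/-- Both readings of row 40 side by side: `R⁺ ++ [familyDetEntangled, familyDetEntangledUncond]` is decided.
[cite: Zhang2022LandauSiegel, §2 (2.32)–(2.33)] -/
theorem rplus_detEntangled_both_decided : ClassDecided (Rplus ++ [familyDetEntangled, familyDetEntangledUncond]) :=
  classDecided_append.2 ⟨rplus_decided,
    classDecided_cons familyDetEntangled_decided (classDecided_cons familyDetEntangledUncond_decided classDecided_nil)⟩

/-! ### The B-det word, qualifier (b) «GIVEN E-102» DISCHARGED in the kernel -/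

/-- **KILL(B-det) INSIDE DET — UNCONDITIONAL AT INTAKE LEVEL.** Both conditional rows of the intake word `bdetWord2` read
OUTRIGHT: every `w2` member (sign-admissible shift detector in the box, one-sided kinked legs) satisfies
`¬ (𝔅_b(u)·𝔅_b(f) < ‖P_b(u,f)‖²)` and every `entangled` member satisfies `¬ (Re m < 0)`
(`Repair.bdet2_verdicts_of_edetPremise edetPremise_unit`). The other two rows of `bdetWord2` (`familyH1`, `familyRCalc`)
never carried a slot. [cite: Zhang2022LandauSiegel, §2 (2.16), (2.18), (2.32)–(2.33); §7 Prop. 7.1 (7.2)] -/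
theorem bdet2_verdicts :
    (∀ d : DetShiftDesign, KBdet (.w2 d) →
        ¬ (FormDet (shiftRecipe d.b) d.u d.u' * FormDet (shiftRecipe d.b) d.f d.f'
            < ‖FormDetPolar (shiftRecipe d.b) d.u d.u' d.f d.f'‖ ^ 2)) ∧
      ∀ e : DetEntangledDesign, KBdet2 (.entangled e) → ¬ ((entangledMain e.a e.b e.h e.h').re < 0) :=
  bdet2_verdicts_of_edetPremise edetPremise_unit

/-- **Every displayed slot of `familyBdet2` holds on its class**: `w2` ↦ `FormDetPSD (shiftRecipe b)` (head 2),
`entangled` ↦ `ConePSD a b` (head 1). [cite: Zhang2022LandauSiegel, §7 Prop. 7.1 p.44 with (7.2)] -/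
theorem bdet2_slots (d : DetShiftDesign) (e : DetEntangledDesign) :
    (KBdet (.w2 d) → FormDetPSD (shiftRecipe d.b)) ∧ (KBdet2 (.entangled e) → ConePSD e.a e.b) :=
  ⟨fun h => monomialConePSD_unit d.b h.1 fun j => h.2.1 j, fun h => DetEntangledDesign.InClass.slot h⟩

end Unconditional

end Repair

end Literature.NumberTheory.LFunctions.Zhang2022
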